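import Summits.BirchSwinnertonDyer.BirchSwinnertonDyer.Theorems.ManinLocalTwoThreeRelativeIharaShiftVanishingBarHolds
import Summits.BirchSwinnertonDyer.BirchSwinnertonDyer.Theorems.ManinLocalTwoThreeGenerationOfNamedInputs
import HarnessLib

/-!
# The generation stubs modulo their named inputs, with E-es-25 discharged

Summit `BirchSwinnertonDyer`, route `ManinLocalTwoThree` (cell bsd-f2-manin), cruxes C3 `ManinPrimeToThreeAtNine`
(stmt-BirchSwinnertonDyer-22968, stub `stub_shiftClass_generation : ShiftClassGenerationThree`) and C2 `ManinOddAtFour`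
(stmt-BirchSwinnertonDyer-22967, generation lever `MultiShiftClassGenerationTwo`).  With the relative Ihara leaf now a theorem
(`relativeIharaShiftVanishingBar_holds`, `Theorems/ManinLocalTwoThreeRelativeIharaShiftVanishingBarHolds.lean`), the named-input
compositions of `Theorems/ManinLocalTwoThreeGenerationOfNamedInputs.lean` lose their `hRI` binders:

* `shiftClassGenerationThree_of_notEisensteinFact` — E-es-19 `ShiftClassGenerationThree` (the C3 generation stub) follows from
  the ONE Literature named fact `not_isEisensteinEigensystem_of_hasIrreducibleModPGaloisRep` (Darmon–Diamond–Taylor 1995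
  Prop. 2.6 (b): irreducible `E[p]`, `p` odd ⟹ `a_ℓ mod p` not Eisenstein; statement-only in the tree) — a CONDITIONAL result
  (the gate records `proof.conditional`); the stub closes when that fact is discharged or the lead recuts it to carry the fact;
* `multiShiftClassGenerationTwo_of_cThreeResidual` — E-es-22 `MultiShiftClassGenerationTwo` follows from the `C₃`-image
  residual alone (`hRes`, = C2 stub `stub_cThreeImageResidual` up to its binders; MEMO-es §25 is the plan for it).

No new definitions; nothing about BSD or Manin's conjecture is proved here.

References: H. Darmon, F. Diamond, R. Taylor, *Fermat's Last Theorem* (1995), Prop. 2.6 (b) [cite: DarmonDiamondTaylor1995,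
Prop. 2.6 (b) p. 53]; cell memo HOME/MEMO-es.md §22–§25.
-/

set_option autoImplicit false
set_option linter.dupNamespace false

noncomputable section

open scoped MatrixGroups ModularForm BigOperators

open CongruenceSubgroup WeierstrassCurve Literature.NumberTheory.EllipticCurves Literature.NumberTheory.EllipticCurves.ModularForms
  Summit.BirchSwinnertonDyer.Rank1Residual.ManinAdditive

namespace Summit.BirchSwinnertonDyer.BirchSwinnertonDyer.Theorems.ManinLocalTwoThree

/-- **C3 generation (E-es-19) from the Darmon–Diamond–Taylor fact alone**: `ShiftClassGenerationThree` holds given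
`not_isEisensteinEigensystem_of_hasIrreducibleModPGaloisRep` (E-es-25 at `(3,3,1)` is `relativeIharaShiftVanishingBar_holds`).
CONDITIONAL on that printed fact. [cite: DarmonDiamondTaylor1995, Prop. 2.6 (b) p. 53] -/
theorem shiftClassGenerationThree_of_notEisensteinFact
    (hF : not_isEisensteinEigensystem_of_hasIrreducibleModPGaloisRep) : ShiftClassGenerationThree :=
  shiftClassGenerationThree_of_relativeIharaShiftVanishingBar (relativeIharaShiftVanishingBar_holds 3 3 1) hF

/-- **C2 generation (E-es-22) from the `C₃`-image residual alone**: `MultiShiftClassGenerationTwo` holds given `hRes`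
(E-es-25 at `(2, t, n)` is `relativeIharaShiftVanishingBar_holds`). [cite: DarmonDiamondTaylor1995, Prop. 2.6 (b) p. 53] -/
theorem multiShiftClassGenerationTwo_of_cThreeResidual
    (hRes : ∀ (W : WeierstrassCurve ℚ) [W.IsElliptic] {N : ℕ} [NeZero N] (f : CuspForm (Gamma0 N) 2),
      IsNewformOf W f → 2 ^ 2 ∣ N → W.HasIrreducibleModPGaloisRep 2 →
      IsEisensteinEigensystem 2
        (fun ℓ : ℕ => algebraMap (ZMod 2) (AlgebraicClosure (ZMod 2)) ((W.LFunction ℓ : ℤ) : ZMod 2)) →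
      ∀ φ : ↥(periodLattice f) →+ ZMod 2,
        (∀ x : ↥(periodLattice f), (x : ℂ) ∈
            periodLattice (∑ T ∈ (insert 8 (N.primeFactors.filter fun q => ¬ q ^ 2 ∣ N)).powerset,
              (-1 : ℂ) ^ T.card • degeneracyMap0 N (8 * N ^ 2) (∏ t ∈ T, t - 1 + 1) 2 f) → φ x = 0) →
        φ = 0) :
    MultiShiftClassGenerationTwo :=
  multiShiftClassGenerationTwo_of_relativeIharaShiftVanishingBar (fun t n => relativeIharaShiftVanishingBar_holds 2 t n) hRes

end Summit.BirchSwinnertonDyer.BirchSwinnertonDyer.Theorems.ManinLocalTwoThree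

end
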